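import Summits.QuantumFields.BalabanUV.T4Continuum.Support.NE3CovariantCalculus
import Summits.QuantumFields.BalabanUV.T4Continuum.Support.SpreadLiftDirection
import Summits.QuantumFields.BalabanUV.T4Continuum.Support.AveragingDeficitHSInner

/-!
# T⁴ programme, node NE3 — row E-MLw-(w4)-P, piece (C5)∕Φ5 «PERTURBATIONS»: THE FLAT GRADIENT OF A DIRECTION FIELD IN A
# NEAR-IDENTITY GAUGE AGAINST ITS COVARIANT GRADIENT (pointwise, summed over any finite site set, op-norm and HS currencies,
# and transported back through a unitary gauge transformation)

NE3 formalisation swarm `b2b-balaban-t4-ne3-formalise-*`, LEAF PROVER 03 (gen 6), row **E-MLw-(w4)-P** of `t4/formal/NE3/LEAVES.md`,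
piece (C5) of the owner's design `D-ne3p1-g21-1.md` §3 ∕ re-cut `D-ne3p1-g21-2.md` §2 (ruling ρ-g21-3, HOME/CLAIMS.log): «the κ-line ∕
double-block perturbation inequalities in comb gauges, parameter `M·a`, all k-free: `gradSq_W` vs the flat `gradSq` of the
gauge-fixed field (`≤ 2d²M²a²·dirSq` extra)».  On the frame-free slice `T_♮(W)` the curved weighted Poincaré (P_W) is to follow
from leaf-04's ONE-BLOCK flat core `NE3BlockPoincareLocal.sum_block_norm_sq_le` applied to the GAUGE-FIXED field in the double-block
comb gauges of row C0 (`NE3CombGauge`, `NE3CombGaugeLine`: `‖W^{lcomb}(x,μ) − 1‖ ≤ (d−1)(M−1)·a` on the κ-line of blocks); the flat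
core consumes FLAT forward differences of the gauge-fixed field, the socket (ML_w) speaks the COVARIANT gradient of the original
field.  THIS FILE is the bridge, stated ONCE for an arbitrary unitary background `V` that is `α`-close to `1` on the bonds used —
the comb gauge then supplies `α = (d−1)(M−1)·a` (or `(d−1)M·a` one layer out), `M·a ≈ b∕(L²·M)`:

* §1 POINTWISE: `‖(ψ(x+e_μ)ν − ψ x ν) − covFd V ψ x μ ν‖ ≤ 4α·‖ψ(x+e_μ)ν‖ + 2α·‖ψ x ν‖` (`norm_fd_sub_covFd_le`; the two `Ad − id`
  defects, `AveragingDeficitNearIdentity.norm_Ad_sub_le`), the triangle form `norm_fd_le`, and the squared forms in op-norm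
  (`norm_fd_sq_le`) and Hilbert–Schmidt (`nhsNormSq_fd_le`) currencies: `‖fd‖² ≤ 2‖covFd‖² + 64α²‖ψ(x+e_μ)ν‖² + 16α²‖ψ x ν‖²`;
* §2 SUMMED over any finite site set `R` on whose bonds (and forward neighbours' bonds) `V` is `α`-close to `1`:
  `Σ_{x∈R}Σ_{μ,ν}‖ψ(x+e_μ)ν − ψ x ν‖² ≤ 2·covGradSq V ψ R + 64α²·Σ_{x∈R}Σ_{μ,ν}‖ψ(x+e_μ)ν‖² + 16·d·α²·dirSq ψ R`
  (`sum_norm_fd_sq_le`) and its HS twin (`sum_nhsNormSq_fd_le`); the converse direction `covGradSq ≤ 2·flat + …`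
  (`covGradSq_le_two_mul_sum_norm_fd_sq_add`);
* §3 THROUGH A GAUGE: for unitary `u`, `V^u = gaugeAct u V`, `ψ^u = dirGauge u ψ`: `covGradSq` and `dirSq` are invariant
  (`AveragingDeficitCovGrad.covGradSq_gaugeAct`, `AveragingDeficitLocality.norm_dirGauge`), so the flat gradient of the
  gauge-fixed field `ψ^u` on `R` is bounded by `2·covGradSq V ψ R + (64 + 16d)·α²·(bond energy of ψ near R)` as soon as the
  gauge-fixed BACKGROUND `V^u` is `α`-close to `1` there (`sum_norm_fd_dirGauge_sq_le`) — the form row C6 feeds into the flat core.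

Elementary (`‖Ad_U X − X‖ ≤ 2‖U − 1‖‖X‖`, `‖V₁V₂ − 1‖ ≤ 2α` for unitary `α`-close factors, `(p+q+r)²`-bookkeeping); no smallness
beyond `0 ≤ α`; every constant explicit and k-free.  Imports `NE3CovariantCalculus` (for `nhsNormSq_sub_le` and the (γ2) covariant
gradient `AveragingDeficitCovGrad.covFd ∕ covGradSq ∕ covFd_gaugeAct`), `SpreadLiftDirection` (`isUnitaryCfg_gaugeAct'`) and
`AveragingDeficitHSInner` (`nhsNormSq_Ad`).

HONEST FRAMING.  Lattice bookkeeping of OUR frame at ONE configuration (context: [Balaban1985Averaging] (11) p.19, (27) p.21 — the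
axial-gauge bond bound that makes `α = O(M·a)`); nothing about Bałaban's minimisers is asserted; (P_W), (ML_w), T-E_w, NE3 NOT
proved; spine PROVED 0∕9; finite T⁴ rung (B)+1 — NOT infinite volume, NOT mass gap, NOT `BetaPertH`, NOT Clay.  No `def`, no
`sorry`.  PLACEMENT: `Summits/QuantumFields/BalabanUV/`.  HONEST DEPENDENCY (cell page 1): continuum YM on T⁴ ⇐ BetaPertH ∧ nine spine
estimates (0/9 proved); BetaPertH ⇐ (D1) ∧ (D4) ∧ CAP+tail; G-an2-4 gates asym, D1 and NE2/3/4.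
-/

set_option autoImplicit false

open scoped BigOperators Matrix Matrix.Norms.L2Operator
open NormedSpace Finset

namespace Summit.QuantumFields.BalabanUV.T4Continuum.NE3NearIdentityGradient

open Literature.MathematicalPhysics.QuantumFieldTheory.Balaban1983to89
open B7Prop1Explicit B7Prop2Explicit MatrixLog UnitaryModel MatrixNorms
open T4AveragingDeficitWall hiding Site Plane Plaq Bond
open T4AveragingDeficitNonAbelian (Ad_mul Ad_sub)
open AveragingDeficitTransport (norm_Ad_of_unitary mem_U1_of_unitary)
open AveragingDeficitNearIdentity (Ad_one norm_Ad_sub_le)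
open AveragingDeficitLocality (dirGauge norm_dirGauge)
open AveragingDeficitCovGrad (covFd covGradSq covFd_gaugeAct covGradSq_gaugeAct)
open NE3CovariantCalculus (nhsNormSq_sub_le)

noncomputable section

variable {d : ℕ} {n : Type*} [Fintype n] [DecidableEq n]

/-! ## §1 Pointwise: the flat forward difference against the covariant one -/

/-- A product of two unitary factors `α`-close to `1` is `2α`-close to `1`: `‖V₁V₂ − 1‖ ≤ ‖V₁ − 1‖ + ‖V₂ − 1‖` (since `‖V₂‖ = 1`).
[folklore] -/
theorem norm_mul_sub_one_le [Nonempty n] {V₁ V₂ : (Matrix n n ℂ)ˣ} (h₂ : V₂ ∈ unitaryUnits (Matrix n n ℂ)) :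
    ‖((V₁ * V₂ : (Matrix n n ℂ)ˣ) : Matrix n n ℂ) - 1‖
      ≤ ‖(V₁ : Matrix n n ℂ) - 1‖ + ‖(V₂ : Matrix n n ℂ) - 1‖ := by
  have hV₂ : ‖(V₂ : Matrix n n ℂ)‖ = 1 := CStarRing.norm_of_mem_unitary (mem_unitaryUnits.mp h₂)
  have hsplit : ((V₁ * V₂ : (Matrix n n ℂ)ˣ) : Matrix n n ℂ) - 1
      = ((V₁ : Matrix n n ℂ) - 1) * (V₂ : Matrix n n ℂ) + ((V₂ : Matrix n n ℂ) - 1) := by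
    rw [Units.val_mul]; noncomm_ring
  rw [hsplit]
  calc ‖((V₁ : Matrix n n ℂ) - 1) * (V₂ : Matrix n n ℂ) + ((V₂ : Matrix n n ℂ) - 1)‖
      ≤ ‖((V₁ : Matrix n n ℂ) - 1) * (V₂ : Matrix n n ℂ)‖ + ‖(V₂ : Matrix n n ℂ) - 1‖ := norm_add_le _ _
    _ ≤ ‖(V₁ : Matrix n n ℂ) - 1‖ * ‖(V₂ : Matrix n n ℂ)‖ + ‖(V₂ : Matrix n n ℂ) - 1‖ := by
        gcongr; exact norm_mul_le _ _
    _ = ‖(V₁ : Matrix n n ℂ) - 1‖ + ‖(V₂ : Matrix n n ℂ) - 1‖ := by rw [hV₂, mul_one]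

/-- **THE FLAT FORWARD DIFFERENCE AGAINST THE COVARIANT ONE, POINTWISE**: for a unitary background whose three bond variables at the
pair `(x; μ, ν)` are `α`-close to `1`,
`‖(ψ(x+e_μ)ν − ψ x ν) − covFd V ψ x μ ν‖ ≤ 4α·‖ψ(x+e_μ)ν‖ + 2α·‖ψ x ν‖`. [folklore] -/
theorem norm_fd_sub_covFd_le [Nonempty n] {V : Site d → Fin d → (Matrix n n ℂ)ˣ} (hV : IsUnitaryCfg V)
    (ψ : Site d → Fin d → Matrix n n ℂ) (x : Site d) (μ ν : Fin d) {α : ℝ}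
    (h₁ : ‖(V x μ : Matrix n n ℂ) - 1‖ ≤ α) (h₂ : ‖(V (x + e μ) ν : Matrix n n ℂ) - 1‖ ≤ α)
    (h₃ : ‖(V x ν : Matrix n n ℂ) - 1‖ ≤ α) :
    ‖(ψ (x + e μ) ν - ψ x ν) - covFd V ψ x μ ν‖ ≤ 4 * α * ‖ψ (x + e μ) ν‖ + 2 * α * ‖ψ x ν‖ := by
  have hα : 0 ≤ α := le_trans (norm_nonneg _) h₁
  have hsplit : (ψ (x + e μ) ν - ψ x ν) - covFd V ψ x μ ν
      = (Ad (V x ν) (ψ x ν) - ψ x ν) - (Ad (V x μ * V (x + e μ) ν) (ψ (x + e μ) ν) - ψ (x + e μ) ν) := by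
    simp only [covFd]; abel
  rw [hsplit]
  have h12 : ‖((V x μ * V (x + e μ) ν : (Matrix n n ℂ)ˣ) : Matrix n n ℂ) - 1‖ ≤ 2 * α := by
    have := norm_mul_sub_one_le (V₁ := V x μ) (hV (x + e μ) ν)
    linarith
  have hA := norm_Ad_sub_le ((unitaryUnits _).mul_mem (hV x μ) (hV (x + e μ) ν)) (ψ (x + e μ) ν)
  have hB := norm_Ad_sub_le (hV x ν) (ψ x ν)
  calc ‖(Ad (V x ν) (ψ x ν) - ψ x ν) - (Ad (V x μ * V (x + e μ) ν) (ψ (x + e μ) ν) - ψ (x + e μ) ν)‖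
      ≤ ‖Ad (V x ν) (ψ x ν) - ψ x ν‖ + ‖Ad (V x μ * V (x + e μ) ν) (ψ (x + e μ) ν) - ψ (x + e μ) ν‖ := norm_sub_le _ _
    _ ≤ 2 * ‖(V x ν : Matrix n n ℂ) - 1‖ * ‖ψ x ν‖
          + 2 * ‖((V x μ * V (x + e μ) ν : (Matrix n n ℂ)ˣ) : Matrix n n ℂ) - 1‖ * ‖ψ (x + e μ) ν‖ := add_le_add hB hA
    _ ≤ 2 * α * ‖ψ x ν‖ + 2 * (2 * α) * ‖ψ (x + e μ) ν‖ := by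
        gcongr
    _ = 4 * α * ‖ψ (x + e μ) ν‖ + 2 * α * ‖ψ x ν‖ := by ring

/-- The triangle form: `‖ψ(x+e_μ)ν − ψ x ν‖ ≤ ‖covFd V ψ x μ ν‖ + 4α‖ψ(x+e_μ)ν‖ + 2α‖ψ x ν‖`. [folklore] -/
theorem norm_fd_le [Nonempty n] {V : Site d → Fin d → (Matrix n n ℂ)ˣ} (hV : IsUnitaryCfg V)
    (ψ : Site d → Fin d → Matrix n n ℂ) (x : Site d) (μ ν : Fin d) {α : ℝ}
    (h₁ : ‖(V x μ : Matrix n n ℂ) - 1‖ ≤ α) (h₂ : ‖(V (x + e μ) ν : Matrix n n ℂ) - 1‖ ≤ α)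
    (h₃ : ‖(V x ν : Matrix n n ℂ) - 1‖ ≤ α) :
    ‖ψ (x + e μ) ν - ψ x ν‖ ≤ ‖covFd V ψ x μ ν‖ + 4 * α * ‖ψ (x + e μ) ν‖ + 2 * α * ‖ψ x ν‖ := by
  have h := norm_fd_sub_covFd_le hV ψ x μ ν h₁ h₂ h₃
  have := norm_le_insert' (ψ (x + e μ) ν - ψ x ν) (covFd V ψ x μ ν)
  linarith

/-- The converse triangle form: `‖covFd V ψ x μ ν‖ ≤ ‖ψ(x+e_μ)ν − ψ x ν‖ + 4α‖ψ(x+e_μ)ν‖ + 2α‖ψ x ν‖`. [folklore] -/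
theorem norm_covFd_le [Nonempty n] {V : Site d → Fin d → (Matrix n n ℂ)ˣ} (hV : IsUnitaryCfg V)
    (ψ : Site d → Fin d → Matrix n n ℂ) (x : Site d) (μ ν : Fin d) {α : ℝ}
    (h₁ : ‖(V x μ : Matrix n n ℂ) - 1‖ ≤ α) (h₂ : ‖(V (x + e μ) ν : Matrix n n ℂ) - 1‖ ≤ α)
    (h₃ : ‖(V x ν : Matrix n n ℂ) - 1‖ ≤ α) :
    ‖covFd V ψ x μ ν‖ ≤ ‖ψ (x + e μ) ν - ψ x ν‖ + 4 * α * ‖ψ (x + e μ) ν‖ + 2 * α * ‖ψ x ν‖ := by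
  have h := norm_fd_sub_covFd_le hV ψ x μ ν h₁ h₂ h₃
  rw [← norm_neg, neg_sub] at h
  have := norm_le_insert' (covFd V ψ x μ ν) (ψ (x + e μ) ν - ψ x ν)
  linarith

/-- Squared, op-norm currency: `‖ψ(x+e_μ)ν − ψ x ν‖² ≤ 2‖covFd V ψ x μ ν‖² + 64α²‖ψ(x+e_μ)ν‖² + 16α²‖ψ x ν‖²`. [folklore] -/
theorem norm_fd_sq_le [Nonempty n] {V : Site d → Fin d → (Matrix n n ℂ)ˣ} (hV : IsUnitaryCfg V)
    (ψ : Site d → Fin d → Matrix n n ℂ) (x : Site d) (μ ν : Fin d) {α : ℝ}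
    (h₁ : ‖(V x μ : Matrix n n ℂ) - 1‖ ≤ α) (h₂ : ‖(V (x + e μ) ν : Matrix n n ℂ) - 1‖ ≤ α)
    (h₃ : ‖(V x ν : Matrix n n ℂ) - 1‖ ≤ α) :
    ‖ψ (x + e μ) ν - ψ x ν‖ ^ 2
      ≤ 2 * ‖covFd V ψ x μ ν‖ ^ 2 + 64 * α ^ 2 * ‖ψ (x + e μ) ν‖ ^ 2 + 16 * α ^ 2 * ‖ψ x ν‖ ^ 2 := by
  have hα : 0 ≤ α := le_trans (norm_nonneg _) h₁
  have h := norm_fd_le hV ψ x μ ν h₁ h₂ h₃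
  have h0 : 0 ≤ ‖ψ (x + e μ) ν - ψ x ν‖ := norm_nonneg _
  have hc : 0 ≤ ‖covFd V ψ x μ ν‖ := norm_nonneg _
  have ha : 0 ≤ 4 * α * ‖ψ (x + e μ) ν‖ := by positivity
  have hb : 0 ≤ 2 * α * ‖ψ x ν‖ := by positivity
  -- `(c + (p + q))² ≤ 2c² + 2(p+q)² ≤ 2c² + 4p² + 4q²`
  nlinarith [sq_nonneg (‖covFd V ψ x μ ν‖ - (4 * α * ‖ψ (x + e μ) ν‖ + 2 * α * ‖ψ x ν‖)),
    sq_nonneg (4 * α * ‖ψ (x + e μ) ν‖ - 2 * α * ‖ψ x ν‖), mul_nonneg h0 h0]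

/-- Squared, converse: `‖covFd V ψ x μ ν‖² ≤ 2‖ψ(x+e_μ)ν − ψ x ν‖² + 64α²‖ψ(x+e_μ)ν‖² + 16α²‖ψ x ν‖²`. [folklore] -/
theorem norm_covFd_sq_le [Nonempty n] {V : Site d → Fin d → (Matrix n n ℂ)ˣ} (hV : IsUnitaryCfg V)
    (ψ : Site d → Fin d → Matrix n n ℂ) (x : Site d) (μ ν : Fin d) {α : ℝ}
    (h₁ : ‖(V x μ : Matrix n n ℂ) - 1‖ ≤ α) (h₂ : ‖(V (x + e μ) ν : Matrix n n ℂ) - 1‖ ≤ α)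
    (h₃ : ‖(V x ν : Matrix n n ℂ) - 1‖ ≤ α) :
    ‖covFd V ψ x μ ν‖ ^ 2
      ≤ 2 * ‖ψ (x + e μ) ν - ψ x ν‖ ^ 2 + 64 * α ^ 2 * ‖ψ (x + e μ) ν‖ ^ 2 + 16 * α ^ 2 * ‖ψ x ν‖ ^ 2 := by
  have hα : 0 ≤ α := le_trans (norm_nonneg _) h₁
  have h := norm_covFd_le hV ψ x μ ν h₁ h₂ h₃
  have h0 : 0 ≤ ‖covFd V ψ x μ ν‖ := norm_nonneg _
  have ha : 0 ≤ 4 * α * ‖ψ (x + e μ) ν‖ := by positivity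
  have hb : 0 ≤ 2 * α * ‖ψ x ν‖ := by positivity
  nlinarith [sq_nonneg (‖ψ (x + e μ) ν - ψ x ν‖ - (4 * α * ‖ψ (x + e μ) ν‖ + 2 * α * ‖ψ x ν‖)),
    sq_nonneg (4 * α * ‖ψ (x + e μ) ν‖ - 2 * α * ‖ψ x ν‖), mul_nonneg h0 h0]

/-- Squared, Hilbert–Schmidt currency (`nhsNormSq ≤ ‖·‖²` on the defect):
`nhsNormSq (ψ(x+e_μ)ν − ψ x ν) ≤ 2·nhsNormSq (covFd V ψ x μ ν) + 64α²‖ψ(x+e_μ)ν‖² + 16α²‖ψ x ν‖²`. [folklore] -/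
theorem nhsNormSq_fd_le [Nonempty n] {V : Site d → Fin d → (Matrix n n ℂ)ˣ} (hV : IsUnitaryCfg V)
    (ψ : Site d → Fin d → Matrix n n ℂ) (x : Site d) (μ ν : Fin d) {α : ℝ}
    (h₁ : ‖(V x μ : Matrix n n ℂ) - 1‖ ≤ α) (h₂ : ‖(V (x + e μ) ν : Matrix n n ℂ) - 1‖ ≤ α)
    (h₃ : ‖(V x ν : Matrix n n ℂ) - 1‖ ≤ α) :
    nhsNormSq (ψ (x + e μ) ν - ψ x ν)
      ≤ 2 * nhsNormSq (covFd V ψ x μ ν) + 64 * α ^ 2 * ‖ψ (x + e μ) ν‖ ^ 2 + 16 * α ^ 2 * ‖ψ x ν‖ ^ 2 := by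
  have hα : 0 ≤ α := le_trans (norm_nonneg _) h₁
  -- `fd = covFd + D` with `‖D‖ ≤ 4α‖ψ'‖ + 2α‖ψ‖`
  set D : Matrix n n ℂ := (ψ (x + e μ) ν - ψ x ν) - covFd V ψ x μ ν with hD
  have hsplit : ψ (x + e μ) ν - ψ x ν = covFd V ψ x μ ν - (-D) := by rw [hD]; abel
  have hDn : ‖D‖ ≤ 4 * α * ‖ψ (x + e μ) ν‖ + 2 * α * ‖ψ x ν‖ := norm_fd_sub_covFd_le hV ψ x μ ν h₁ h₂ h₃
  have h1 := nhsNormSq_sub_le (covFd V ψ x μ ν) (-D)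
  rw [← hsplit, NE3CovariantCalculus.nhsNormSq_neg] at h1
  have h2 : nhsNormSq D ≤ ‖D‖ ^ 2 := nhsNormSq_le_opNorm_sq D
  have h3 : ‖D‖ ^ 2 ≤ (4 * α * ‖ψ (x + e μ) ν‖ + 2 * α * ‖ψ x ν‖) ^ 2 :=
    pow_le_pow_left₀ (norm_nonneg _) hDn 2
  have ha : 0 ≤ 4 * α * ‖ψ (x + e μ) ν‖ := by positivity
  have hb : 0 ≤ 2 * α * ‖ψ x ν‖ := by positivity
  nlinarith [sq_nonneg (4 * α * ‖ψ (x + e μ) ν‖ - 2 * α * ‖ψ x ν‖)]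

/-! ## §2 Summed over a finite site set -/

/-- **THE FLAT GRADIENT ENERGY AGAINST THE COVARIANT ONE ON A FINITE SITE SET** (op-norm currency): if every bond variable
`V(x,μ)`, `x ∈ R`, and every `V(x+e_μ, ν)`, `x ∈ R`, is `α`-close to `1`, then
`Σ_{x∈R}Σ_{μ,ν}‖ψ(x+e_μ)ν − ψ x ν‖² ≤ 2·covGradSq V ψ R + 64α²·Σ_{x∈R}Σ_{μ,ν}‖ψ(x+e_μ)ν‖² + 16·d·α²·dirSq ψ R`. [folklore] -/
theorem sum_norm_fd_sq_le [Nonempty n] {V : Site d → Fin d → (Matrix n n ℂ)ˣ} (hV : IsUnitaryCfg V)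
    (ψ : Site d → Fin d → Matrix n n ℂ) (R : Finset (Site d)) {α : ℝ}
    (hR : ∀ x ∈ R, ∀ μ, ‖(V x μ : Matrix n n ℂ) - 1‖ ≤ α)
    (hR' : ∀ x ∈ R, ∀ μ ν, ‖(V (x + e μ) ν : Matrix n n ℂ) - 1‖ ≤ α) :
    ∑ x ∈ R, ∑ μ : Fin d, ∑ ν : Fin d, ‖ψ (x + e μ) ν - ψ x ν‖ ^ 2
      ≤ 2 * covGradSq V ψ R + 64 * α ^ 2 * ∑ x ∈ R, ∑ μ : Fin d, ∑ ν : Fin d, ‖ψ (x + e μ) ν‖ ^ 2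
        + 16 * d * α ^ 2 * dirSq ψ R := by
  unfold covGradSq dirSq
  have hpt : ∀ x ∈ R, ∀ μ ν, ‖ψ (x + e μ) ν - ψ x ν‖ ^ 2
      ≤ 2 * ‖covFd V ψ x μ ν‖ ^ 2 + 64 * α ^ 2 * ‖ψ (x + e μ) ν‖ ^ 2 + 16 * α ^ 2 * ‖ψ x ν‖ ^ 2 :=
    fun x hx μ ν => norm_fd_sq_le hV ψ x μ ν (hR x hx μ) (hR' x hx μ ν) (hR x hx ν)
  have hsum := Finset.sum_le_sum fun x hx => Finset.sum_le_sum fun μ (_ : μ ∈ (univ : Finset (Fin d))) =>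
    Finset.sum_le_sum fun ν (_ : ν ∈ (univ : Finset (Fin d))) => hpt x hx μ ν
  refine hsum.trans (le_of_eq ?_)
  have hin : ∑ x ∈ R, ∑ μ : Fin d, ∑ ν : Fin d, ‖ψ x ν‖ ^ 2 = (d : ℝ) * ∑ x ∈ R, ∑ ν : Fin d, ‖ψ x ν‖ ^ 2 := by
    rw [Finset.mul_sum]
    refine Finset.sum_congr rfl fun x _ => ?_
    rw [Finset.sum_const, Finset.card_univ, Fintype.card_fin, nsmul_eq_mul]
  simp only [Finset.sum_add_distrib, ← Finset.mul_sum]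
  rw [hin]
  ring

/-- **THE CONVERSE**: `covGradSq V ψ R ≤ 2·Σ_{x∈R}Σ_{μ,ν}‖ψ(x+e_μ)ν − ψ x ν‖² + 64α²·Σ_{x∈R}Σ_{μ,ν}‖ψ(x+e_μ)ν‖² + 16·d·α²·dirSq ψ R`.
[folklore] -/
theorem covGradSq_le_two_mul_sum_norm_fd_sq_add [Nonempty n] {V : Site d → Fin d → (Matrix n n ℂ)ˣ} (hV : IsUnitaryCfg V)
    (ψ : Site d → Fin d → Matrix n n ℂ) (R : Finset (Site d)) {α : ℝ}
    (hR : ∀ x ∈ R, ∀ μ, ‖(V x μ : Matrix n n ℂ) - 1‖ ≤ α)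
    (hR' : ∀ x ∈ R, ∀ μ ν, ‖(V (x + e μ) ν : Matrix n n ℂ) - 1‖ ≤ α) :
    covGradSq V ψ R
      ≤ 2 * ∑ x ∈ R, ∑ μ : Fin d, ∑ ν : Fin d, ‖ψ (x + e μ) ν - ψ x ν‖ ^ 2
        + 64 * α ^ 2 * ∑ x ∈ R, ∑ μ : Fin d, ∑ ν : Fin d, ‖ψ (x + e μ) ν‖ ^ 2 + 16 * d * α ^ 2 * dirSq ψ R := by
  unfold covGradSq dirSq
  have hpt : ∀ x ∈ R, ∀ μ ν, ‖covFd V ψ x μ ν‖ ^ 2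
      ≤ 2 * ‖ψ (x + e μ) ν - ψ x ν‖ ^ 2 + 64 * α ^ 2 * ‖ψ (x + e μ) ν‖ ^ 2 + 16 * α ^ 2 * ‖ψ x ν‖ ^ 2 :=
    fun x hx μ ν => norm_covFd_sq_le hV ψ x μ ν (hR x hx μ) (hR' x hx μ ν) (hR x hx ν)
  have hsum := Finset.sum_le_sum fun x hx => Finset.sum_le_sum fun μ (_ : μ ∈ (univ : Finset (Fin d))) =>
    Finset.sum_le_sum fun ν (_ : ν ∈ (univ : Finset (Fin d))) => hpt x hx μ ν
  refine hsum.trans (le_of_eq ?_)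
  have hin : ∑ x ∈ R, ∑ μ : Fin d, ∑ ν : Fin d, ‖ψ x ν‖ ^ 2 = (d : ℝ) * ∑ x ∈ R, ∑ ν : Fin d, ‖ψ x ν‖ ^ 2 := by
    rw [Finset.mul_sum]
    refine Finset.sum_congr rfl fun x _ => ?_
    rw [Finset.sum_const, Finset.card_univ, Fintype.card_fin, nsmul_eq_mul]
  simp only [Finset.sum_add_distrib, ← Finset.mul_sum]
  rw [hin]
  ring

/-- The Hilbert–Schmidt twin of `sum_norm_fd_sq_le`:
`Σ_{x∈R}Σ_{μ,ν} nhsNormSq (ψ(x+e_μ)ν − ψ x ν) ≤ 2·Σ_{x∈R}Σ_{μ,ν} nhsNormSq (covFd V ψ x μ ν) + 64α²·Σ‖ψ(x+e_μ)ν‖² + 16·d·α²·dirSq ψ R`.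
[folklore] -/
theorem sum_nhsNormSq_fd_le [Nonempty n] {V : Site d → Fin d → (Matrix n n ℂ)ˣ} (hV : IsUnitaryCfg V)
    (ψ : Site d → Fin d → Matrix n n ℂ) (R : Finset (Site d)) {α : ℝ}
    (hR : ∀ x ∈ R, ∀ μ, ‖(V x μ : Matrix n n ℂ) - 1‖ ≤ α)
    (hR' : ∀ x ∈ R, ∀ μ ν, ‖(V (x + e μ) ν : Matrix n n ℂ) - 1‖ ≤ α) :
    ∑ x ∈ R, ∑ μ : Fin d, ∑ ν : Fin d, nhsNormSq (ψ (x + e μ) ν - ψ x ν)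
      ≤ 2 * ∑ x ∈ R, ∑ μ : Fin d, ∑ ν : Fin d, nhsNormSq (covFd V ψ x μ ν)
        + 64 * α ^ 2 * ∑ x ∈ R, ∑ μ : Fin d, ∑ ν : Fin d, ‖ψ (x + e μ) ν‖ ^ 2 + 16 * d * α ^ 2 * dirSq ψ R := by
  unfold dirSq
  have hpt : ∀ x ∈ R, ∀ μ ν, nhsNormSq (ψ (x + e μ) ν - ψ x ν)
      ≤ 2 * nhsNormSq (covFd V ψ x μ ν) + 64 * α ^ 2 * ‖ψ (x + e μ) ν‖ ^ 2 + 16 * α ^ 2 * ‖ψ x ν‖ ^ 2 :=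
    fun x hx μ ν => nhsNormSq_fd_le hV ψ x μ ν (hR x hx μ) (hR' x hx μ ν) (hR x hx ν)
  have hsum := Finset.sum_le_sum fun x hx => Finset.sum_le_sum fun μ (_ : μ ∈ (univ : Finset (Fin d))) =>
    Finset.sum_le_sum fun ν (_ : ν ∈ (univ : Finset (Fin d))) => hpt x hx μ ν
  refine hsum.trans (le_of_eq ?_)
  have hin : ∑ x ∈ R, ∑ μ : Fin d, ∑ ν : Fin d, ‖ψ x ν‖ ^ 2 = (d : ℝ) * ∑ x ∈ R, ∑ ν : Fin d, ‖ψ x ν‖ ^ 2 := by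
    rw [Finset.mul_sum]
    refine Finset.sum_congr rfl fun x _ => ?_
    rw [Finset.sum_const, Finset.card_univ, Fintype.card_fin, nsmul_eq_mul]
  simp only [Finset.sum_add_distrib, ← Finset.mul_sum]
  rw [hin]
  ring

/-! ## §3 Through a unitary gauge transformation -/

/-- The bond energy is gauge invariant: `dirSq (dirGauge u ψ) R = dirSq ψ R` for unitary `u`. [folklore] -/
theorem dirSq_dirGauge [Nonempty n] {u : Site d → (Matrix n n ℂ)ˣ} (hu : ∀ x, u x ∈ unitaryUnits (Matrix n n ℂ))
    (ψ : Site d → Fin d → Matrix n n ℂ) (R : Finset (Site d)) : dirSq (dirGauge u ψ) R = dirSq ψ R := by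
  unfold dirSq
  simp only [norm_dirGauge hu]

/-- The shifted bond energy is gauge invariant as well. [folklore] -/
theorem sum_norm_dirGauge_shift_sq [Nonempty n] {u : Site d → (Matrix n n ℂ)ˣ} (hu : ∀ x, u x ∈ unitaryUnits (Matrix n n ℂ))
    (ψ : Site d → Fin d → Matrix n n ℂ) (R : Finset (Site d)) :
    ∑ x ∈ R, ∑ μ : Fin d, ∑ ν : Fin d, ‖dirGauge u ψ (x + e μ) ν‖ ^ 2
      = ∑ x ∈ R, ∑ μ : Fin d, ∑ ν : Fin d, ‖ψ (x + e μ) ν‖ ^ 2 := by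
  simp only [norm_dirGauge hu]

/-- **THE FLAT GRADIENT OF THE GAUGE-FIXED FIELD AGAINST THE COVARIANT GRADIENT OF THE ORIGINAL ONE**: for unitary `u` such that the
gauge-fixed background `V^u = gaugeAct u V` is `α`-close to `1` on the bonds at and ahead of `R`,
`Σ_{x∈R}Σ_{μ,ν}‖ψ^u(x+e_μ)ν − ψ^u x ν‖² ≤ 2·covGradSq V ψ R + 64α²·Σ_{x∈R}Σ_{μ,ν}‖ψ(x+e_μ)ν‖² + 16·d·α²·dirSq ψ R`, `ψ^u = dirGauge u ψ`
(`covGradSq` and the bond energies are gauge invariant).  With row C0's comb gauge on a double block this is the (C5) inequality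
«flat gradSq of the gauge-fixed field ≤ 2·gradSq_W + O(d²M²a²)·dirSq». [folklore] -/
theorem sum_norm_fd_dirGauge_sq_le [Nonempty n] {V : Site d → Fin d → (Matrix n n ℂ)ˣ} (hV : IsUnitaryCfg V)
    {u : Site d → (Matrix n n ℂ)ˣ} (hu : ∀ x, u x ∈ unitaryUnits (Matrix n n ℂ))
    (ψ : Site d → Fin d → Matrix n n ℂ) (R : Finset (Site d)) {α : ℝ}
    (hR : ∀ x ∈ R, ∀ μ, ‖((gaugeAct u V x μ : (Matrix n n ℂ)ˣ) : Matrix n n ℂ) - 1‖ ≤ α)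
    (hR' : ∀ x ∈ R, ∀ μ ν, ‖((gaugeAct u V (x + e μ) ν : (Matrix n n ℂ)ˣ) : Matrix n n ℂ) - 1‖ ≤ α) :
    ∑ x ∈ R, ∑ μ : Fin d, ∑ ν : Fin d, ‖dirGauge u ψ (x + e μ) ν - dirGauge u ψ x ν‖ ^ 2
      ≤ 2 * covGradSq V ψ R + 64 * α ^ 2 * ∑ x ∈ R, ∑ μ : Fin d, ∑ ν : Fin d, ‖ψ (x + e μ) ν‖ ^ 2
        + 16 * d * α ^ 2 * dirSq ψ R := by
  have hVu : IsUnitaryCfg (gaugeAct u V) := SpreadLiftDirection.isUnitaryCfg_gaugeAct' hu hV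
  have h := sum_norm_fd_sq_le hVu (dirGauge u ψ) R hR hR'
  rw [covGradSq_gaugeAct hu, dirSq_dirGauge hu, sum_norm_dirGauge_shift_sq hu] at h
  exact h

/-- The Hilbert–Schmidt twin through the gauge: `Σ nhsNormSq (ψ^u(x+e_μ)ν − ψ^u x ν) ≤ 2·Σ nhsNormSq (covFd V ψ x μ ν) + 64α²·Σ‖ψ(x+e_μ)ν‖²
 + 16·d·α²·dirSq ψ R` (`nhsNormSq` is `Ad`-invariant). [folklore] -/
theorem sum_nhsNormSq_fd_dirGauge_le [Nonempty n] {V : Site d → Fin d → (Matrix n n ℂ)ˣ} (hV : IsUnitaryCfg V)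
    {u : Site d → (Matrix n n ℂ)ˣ} (hu : ∀ x, u x ∈ unitaryUnits (Matrix n n ℂ))
    (ψ : Site d → Fin d → Matrix n n ℂ) (R : Finset (Site d)) {α : ℝ}
    (hR : ∀ x ∈ R, ∀ μ, ‖((gaugeAct u V x μ : (Matrix n n ℂ)ˣ) : Matrix n n ℂ) - 1‖ ≤ α)
    (hR' : ∀ x ∈ R, ∀ μ ν, ‖((gaugeAct u V (x + e μ) ν : (Matrix n n ℂ)ˣ) : Matrix n n ℂ) - 1‖ ≤ α) :
    ∑ x ∈ R, ∑ μ : Fin d, ∑ ν : Fin d, nhsNormSq (dirGauge u ψ (x + e μ) ν - dirGauge u ψ x ν)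
      ≤ 2 * ∑ x ∈ R, ∑ μ : Fin d, ∑ ν : Fin d, nhsNormSq (covFd V ψ x μ ν)
        + 64 * α ^ 2 * ∑ x ∈ R, ∑ μ : Fin d, ∑ ν : Fin d, ‖ψ (x + e μ) ν‖ ^ 2 + 16 * d * α ^ 2 * dirSq ψ R := by
  have hVu : IsUnitaryCfg (gaugeAct u V) := SpreadLiftDirection.isUnitaryCfg_gaugeAct' hu hV
  have h := sum_nhsNormSq_fd_le hVu (dirGauge u ψ) R hR hR'
  rw [dirSq_dirGauge hu, sum_norm_dirGauge_shift_sq hu] at h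
  simp only [covFd_gaugeAct, AveragingDeficitHSInner.nhsNormSq_Ad (hu _)] at h
  exact h

end

end Summit.QuantumFields.BalabanUV.T4Continuum.NE3NearIdentityGradient
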